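/-
Copyright (c) 2026 the pub-hodgecm-mathlib formalisation cell (harness21).  Prover seat hodgecm-mathlib-B-p04 (g61), req618 STAGE 1a «FOUR-FRAME» squad (director s1808;
LEAD directive T17-27 b9ecbbedecc9c5ae D3 day 1, D7 «B-p04 — A-0 port»): the tree PORT of the HOME proof certificate `CERT-A0-ModuleCriterion.v1.F0P3ap01g30.lean`
(F0P3a-p01 (g30), sha16 c9892035ba7f5d54, rc 0·0·0·0, axioms TRIO) — proof body §P verbatim, re-homed over the tree notions module `UnitaryThreeFourFrameDefs` (dealer LH4-plan (g10) WORD #1 deal g10-#3 «A-0 PORT», path + head BY NAME).  2026-09-03.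
-/
import Literature.NumberTheory.Automorphic.UnitaryThreeFourFrameDefs         -- dealer g10-#0 «DEFS-1» (Literature notions half): §H tokens `frameProj`, `IsFourFrameFamily`, `frameElt`, `defectSet`; §A named statement `ModuleCriterion`
import Literature.NumberTheory.Automorphic.UnitaryLatticeTreeOrderStability  -- ★ `mapGL_eq_iff_map_toLin'_le` (stability under `X` ↔ fixed by a unit generating the same order; Kottwitz 1986 §3)
import HarnessLib

/-!
# The MODULE CRITERION for the four-frame fixed-vertex census on the `U(3)` lattice tree at `Φ₃` — `moduleCriterion_holds : ModuleCriterion` (unit (i), item A-0)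

Topic `NumberTheory/Automorphic`; namespace `Literature.NumberTheory.Automorphic.UnitaryThreeFourFrame`.  Cell `pub/hodgecm-mathlib` (D-0151), crux H413 =
`stmt-HodgeConjecture-24833`, organ (D-RAM) `stub_DyRamCore`, «FOUR-FRAME» road, unit (i) of the desk price; DISCHARGES the named statement A-0 `ModuleCriterion` of
`UnitaryThreeFourFrameDefs` (sheet of record v2 c03c627160493264 §A): in each frame `b` of a four-frame family and for EVERY lattice `Λ = latt g`,
`γ_b·Λ = Λ ⟺ (α − 1, β − 1) ∈ M_Λ^{(b)}`, where `γ_b = 1 + (α−1)π₁ + (β−1)π₂` and `M_Λ = {(δ₁, δ₂) | (δ₁π₁ + δ₂π₂)Λ ⊆ Λ}`.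

PROOF ([Kottwitz1986, §3]: a lattice is fixed by a unit `u` iff it is stable under any `X` with `𝒪[u] = 𝒪[X]` — ★ `mapGL_eq_iff_map_toLin'_le`).  With `X = γ_b − 1 =
(α−1)π₁ + (β−1)π₂`: `γ_b = 1 + X ∈ 𝒪[X]`, `X ∈ 𝒪[γ_b]`, and `γ_b⁻¹ = 1 + (α⁻¹−1)π₁ + (β⁻¹−1)π₂ = 1 + c·X + c′·X² ∈ 𝒪[X]` with `c = (1−α−β)∕(αβ)`, `c′ = 1∕(αβ)` — both in `𝒪`
because the `σ`-norm-one scalars `α, β` are units of `𝒪` — by the frame-projection calculus `π_iπ_j = δ_ij π_i` of a `Φ₃`-orthogonal frame (P-1…P-4, [Jacobowitz1962, §4]) and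
the spectral identities P-5, P-6 (`diag(α, β, 1)·diag(α⁻¹, β⁻¹, 1) = 1` written frame-free).

* §P1 P-1 `vecMul_dotProduct_eq_pairing`, P-2 `rankOne_mul_rankOne`, P-3 `frameProj_mul_frameProj_of_pairing_eq_zero`, P-4 `frameProj_mul_self` — PUBLIC: the A-1 port
  (defect-module shape) re-uses them by import instead of re-declaring them.
* §P2 P-5 `one_add_mul_one_add_eq_one`, P-6 `one_add_inv_eq_polynomial` (two orthogonal idempotents, any field).
* §P3 the head `moduleCriterion_holds`.

HONEST LABEL: HC_CM is proved only modulo the 7 printed citations (2 remaining named inputs: hLiu418 = stmt-HodgeConjecture-24832, h413 = stmt-HodgeConjecture-24833) until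
rung 0 closes; this file proves one elementary lemma of the (D-RAM) road and moves no verdict and no registry.
-/

set_option autoImplicit false

noncomputable section

open scoped Valued WithZero Matrix MatrixGroups
open Finset Classical

namespace Literature.NumberTheory.Automorphic.UnitaryThreeFourFrame

open Literature.NumberTheory.Automorphic Literature.NumberTheory.Automorphic.HermitianLattice
  Literature.NumberTheory.Automorphic.UnitaryLatticeTree

/-! ## §P  Proof of A-0 (HOME certificate c9892035ba7f5d54 §P, F0P3a-p01 (g30)): the frame-projection calculus `π_iπ_j = δ_ij π_i`, the explicit inverse of `γ_b`, and ★ `mapGL_eq_iff_map_toLin'_le`. -/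

section ProofA0

variable {K : Type} [Field K] [Valued K ℤᵐ⁰]

omit [Valued K ℤᵐ⁰] in
/-- P-1 · `((σ∘f) ᵥ* H) ⬝ᵥ g = ⟨f, g⟩_H` — the row vector `(σf)ᵀH` paired with `g` is the ★ `pairing`. [cite: Jacobowitz1962, §4] [cite: Kottwitz1986, §3] -/
theorem vecMul_dotProduct_eq_pairing (σ : K →+* K) (H : Matrix (Fin 3) (Fin 3) K) (f g : Fin 3 → K) :
    Matrix.vecMul (fun m => σ (f m)) H ⬝ᵥ g = pairing σ H f g := by
  rw [pairing_apply, ← Matrix.dotProduct_mulVec]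
  simp only [dotProduct, Matrix.mulVec, Finset.mul_sum, mul_assoc]

omit [Valued K ℤᵐ⁰] in
/-- P-2 · PRODUCT OF TWO RANK-ONE FRAME MATRICES: `(f·(σf)ᵀH)·(g·(σg)ᵀH) = ⟨f, g⟩_H · f·(σg)ᵀH`. [cite: Jacobowitz1962, §4] [cite: Kottwitz1986, §3] -/
theorem rankOne_mul_rankOne (σ : K →+* K) (H : Matrix (Fin 3) (Fin 3) K) (f g : Fin 3 → K) :
    Matrix.vecMulVec f (Matrix.vecMul (fun m => σ (f m)) H) * Matrix.vecMulVec g (Matrix.vecMul (fun m => σ (g m)) H) =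
      pairing σ H f g • Matrix.vecMulVec f (Matrix.vecMul (fun m => σ (g m)) H) := by
  rw [Matrix.vecMulVec_mul_vecMulVec, vecMul_dotProduct_eq_pairing, Matrix.vecMulVec_smul]

omit [Valued K ℤᵐ⁰] in
/-- P-3 · ORTHOGONAL FRAME VECTORS GIVE ORTHOGONAL PROJECTIONS: `⟨f, g⟩ = 0 ⇒ π_f π_g = 0` (H3 `frameProj` at Φ₃). [cite: Jacobowitz1962, §4] [cite: Kottwitz1986, §3] -/
theorem frameProj_mul_frameProj_of_pairing_eq_zero (σ : K →+* K) {f g : Fin 3 → K}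
    (hfg : pairing σ ((StdForm.antidiagonal 3).over K) f g = 0) : frameProj σ f * frameProj σ g = 0 := by
  rw [frameProj, frameProj, Matrix.smul_mul, Matrix.mul_smul, rankOne_mul_rankOne, hfg, zero_smul, smul_zero, smul_zero]

omit [Valued K ℤᵐ⁰] in
/-- P-4 · A FRAME PROJECTION IS IDEMPOTENT: `N(f) ≠ 0 ⇒ π_f π_f = π_f` (H3 `frameProj` at Φ₃). [cite: Jacobowitz1962, §4] [cite: Kottwitz1986, §3] -/
theorem frameProj_mul_self (σ : K →+* K) {f : Fin 3 → K}
    (hf : pairing σ ((StdForm.antidiagonal 3).over K) f f ≠ 0) : frameProj σ f * frameProj σ f = frameProj σ f := by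
  rw [frameProj, Matrix.smul_mul, Matrix.mul_smul, rankOne_mul_rankOne, smul_smul, smul_smul, inv_mul_cancel_right₀ hf]

/-- P-5 · SPECTRAL INVERSE for two orthogonal idempotents `P₀, P₁` (`P_iP_j = δ_ij P_i`) and units `α, β`:
`(1 + (α−1)P₀ + (β−1)P₁)·(1 + (α⁻¹−1)P₀ + (β⁻¹−1)P₁) = 1` (i.e. `diag(α, β, 1)·diag(α⁻¹, β⁻¹, 1) = 1` frame-free). [cite: Kottwitz1986, §3] -/
theorem one_add_mul_one_add_eq_one {R : Type*} [Field R] {n : Type*} [Fintype n] [DecidableEq n]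
    {P₀ P₁ : Matrix n n R} (h00 : P₀ * P₀ = P₀) (h11 : P₁ * P₁ = P₁) (h01 : P₀ * P₁ = 0) (h10 : P₁ * P₀ = 0)
    {α β : R} (hα : α ≠ 0) (hβ : β ≠ 0) :
    (1 + ((α - 1) • P₀ + (β - 1) • P₁)) * (1 + ((α⁻¹ - 1) • P₀ + (β⁻¹ - 1) • P₁)) = 1 := by
  have h1 : (α - 1) + (α⁻¹ - 1) + (α - 1) * (α⁻¹ - 1) = 0 := by field_simp; ring
  have h2 : (β - 1) + (β⁻¹ - 1) + (β - 1) * (β⁻¹ - 1) = 0 := by field_simp; ring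
  calc (1 + ((α - 1) • P₀ + (β - 1) • P₁)) * (1 + ((α⁻¹ - 1) • P₀ + (β⁻¹ - 1) • P₁))
        = 1 + ((α - 1) + (α⁻¹ - 1) + (α - 1) * (α⁻¹ - 1)) • P₀ + ((β - 1) + (β⁻¹ - 1) + (β - 1) * (β⁻¹ - 1)) • P₁ := by
          simp only [add_mul, mul_add, one_mul, mul_one, Matrix.smul_mul, Matrix.mul_smul, smul_smul, h00, h01, h10, h11, smul_zero, add_zero]
          module
    _ = 1 := by rw [h1, h2, zero_smul, zero_smul, add_zero, add_zero]

/-- P-6 · THE INVERSE IS AN `𝒪`-POLYNOMIAL IN `X = (α−1)P₀ + (β−1)P₁`: `1 + (α⁻¹−1)P₀ + (β⁻¹−1)P₁ = 1 + c·X + c′·X²` with `c = (1−α−β)∕(αβ)`, `c′ = (αβ)⁻¹`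
(from `X² = (α−1)²P₀ + (β−1)²P₁` and `c(α−1) + c′(α−1)² = α⁻¹ − 1`; the characteristic polynomial `(x−α)(x−β)(x−1)` of `γ_b`). [cite: Kottwitz1986, §3] -/
theorem one_add_inv_eq_polynomial {R : Type*} [Field R] {n : Type*} [Fintype n] [DecidableEq n]
    {P₀ P₁ : Matrix n n R} (h00 : P₀ * P₀ = P₀) (h11 : P₁ * P₁ = P₁) (h01 : P₀ * P₁ = 0) (h10 : P₁ * P₀ = 0)
    {α β : R} (hα : α ≠ 0) (hβ : β ≠ 0) :
    1 + ((α⁻¹ - 1) • P₀ + (β⁻¹ - 1) • P₁) =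
      1 + ((1 - α - β) / (α * β)) • ((α - 1) • P₀ + (β - 1) • P₁) +
        (α * β)⁻¹ • (((α - 1) • P₀ + (β - 1) • P₁) * ((α - 1) • P₀ + (β - 1) • P₁)) := by
  have hXX : ((α - 1) • P₀ + (β - 1) • P₁) * ((α - 1) • P₀ + (β - 1) • P₁) = ((α - 1) * (α - 1)) • P₀ + ((β - 1) * (β - 1)) • P₁ := by
    simp only [add_mul, mul_add, Matrix.smul_mul, Matrix.mul_smul, smul_smul, h00, h01, h10, h11, smul_zero, add_zero, zero_add]
  have hc1 : (1 - α - β) / (α * β) * (α - 1) + (α * β)⁻¹ * ((α - 1) * (α - 1)) = α⁻¹ - 1 := by field_simp; ring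
  have hc2 : (1 - α - β) / (α * β) * (β - 1) + (α * β)⁻¹ * ((β - 1) * (β - 1)) = β⁻¹ - 1 := by field_simp; ring
  rw [hXX, ← hc1, ← hc2]
  module

/-- **A-0 · THE MODULE CRITERION HOLDS** (memo v1.4 §2 (A); SIGSHEET v2 §A A-0, tokens verbatim): in each frame `b` and for every lattice `Λ = latt g`,
`γ_b·Λ = Λ ⟺ (α − 1, β − 1) ∈ M_Λ^{(b)}`.  Proof: `M_Λ ∋ (α−1, β−1)` says `X·Λ ⊆ Λ` for `X = γ_b − 1`; `γ_b = 1 + X` and `γ_b⁻¹ = 1 + c·X + c′·X²` lie in the order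
`𝒪[X]` (P-5, P-6; `c, c′ ∈ 𝒪` since `|α| = |β| = 1`), and `X ∈ 𝒪[γ_b]`, so ★ `mapGL_eq_iff_map_toLin'_le` (stability under `X` ↔ fixed by the unit `γ_b`) applies. [cite: Kottwitz1986, §3] [cite: Rogawski1990, §4.9 Prop. 4.9.1 (a) p. 55] -/
theorem moduleCriterion_holds : ModuleCriterion := by
  intro K _ _ σ _hσσ hvσ f hf α β hα hβ b Γ hΓ g
  -- `σ`-norm-one scalars are units of `𝒪`
  have hv1 : ∀ {x : K}, x * σ x = 1 → Valued.v x = 1 := fun {x} hx => by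
    have h : Valued.v x * Valued.v x = 1 := by rw [← hvσ x]; nth_rw 1 [hvσ x]; rw [← map_mul, hx, map_one]
    rw [← pow_two] at h
    exact ((pow_eq_one_iff).1 h).resolve_right two_ne_zero
  have hα0 : α ≠ 0 := fun h => by rw [h, zero_mul] at hα; exact zero_ne_one hα
  have hβ0 : β ≠ 0 := fun h => by rw [h, zero_mul] at hβ; exact zero_ne_one hβ
  have hvα : Valued.v α = 1 := hv1 hα
  have hvβ : Valued.v β = 1 := hv1 hβ
  -- the projection calculus in frame `b`
  obtain ⟨horth, hnz, -, -, -⟩ := hf b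
  have h00 := frameProj_mul_self σ (hnz 0)
  have h11 := frameProj_mul_self σ (hnz 1)
  have h01 := frameProj_mul_frameProj_of_pairing_eq_zero σ (horth 0 1 (by decide))
  have h10 := frameProj_mul_frameProj_of_pairing_eq_zero σ (horth 1 0 (by decide))
  -- `γ_b = 1 + X`
  have hΓX : (Γ : Matrix (Fin 3) (Fin 3) K) = 1 + ((α - 1) • frameProj σ (f b 0) + (β - 1) • frameProj σ (f b 1)) := by
    rw [hΓ, frameElt, add_assoc]
  have hX : (Γ : Matrix (Fin 3) (Fin 3) K) - 1 = (α - 1) • frameProj σ (f b 0) + (β - 1) • frameProj σ (f b 1) := by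
    rw [hΓX, add_sub_cancel_left]
  -- the three order memberships
  have hu : (Γ : Matrix (Fin 3) (Fin 3) K) ∈
      Algebra.adjoin 𝒪[K] ({(α - 1) • frameProj σ (f b 0) + (β - 1) • frameProj σ (f b 1)} : Set (Matrix (Fin 3) (Fin 3) K)) := by
    rw [hΓX]
    exact add_mem (Subalgebra.one_mem _) (Algebra.self_mem_adjoin_singleton _ _)
  have hXm : (α - 1) • frameProj σ (f b 0) + (β - 1) • frameProj σ (f b 1) ∈
      Algebra.adjoin 𝒪[K] ({(Γ : Matrix (Fin 3) (Fin 3) K)} : Set (Matrix (Fin 3) (Fin 3) K)) := by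
    rw [← hX]
    exact sub_mem (Algebra.self_mem_adjoin_singleton _ _) (Subalgebra.one_mem _)
  have hu' : ((Γ⁻¹ : GL (Fin 3) K) : Matrix (Fin 3) (Fin 3) K) ∈
      Algebra.adjoin 𝒪[K] ({(α - 1) • frameProj σ (f b 0) + (β - 1) • frameProj σ (f b 1)} : Set (Matrix (Fin 3) (Fin 3) K)) := by
    have hinv : ((Γ⁻¹ : GL (Fin 3) K) : Matrix (Fin 3) (Fin 3) K) = 1 + ((α⁻¹ - 1) • frameProj σ (f b 0) + (β⁻¹ - 1) • frameProj σ (f b 1)) := by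
      rw [Matrix.coe_units_inv]
      exact Matrix.inv_eq_right_inv (by rw [hΓX]; exact one_add_mul_one_add_eq_one h00 h11 h01 h10 hα0 hβ0)
    rw [hinv, one_add_inv_eq_polynomial h00 h11 h01 h10 hα0 hβ0]
    have hc : Valued.v ((1 - α - β) / (α * β)) ≤ 1 := by
      rw [map_div₀, map_mul, hvα, hvβ, mul_one, div_one]
      refine (Valuation.map_sub _ _ _).trans (max_le ((Valuation.map_sub _ _ _).trans (max_le ?_ hvα.le)) hvβ.le)
      rw [map_one]
    have hc' : Valued.v (α * β)⁻¹ ≤ 1 := by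
      rw [map_inv₀, map_mul, hvα, hvβ, mul_one, inv_one]
    refine add_mem (add_mem (Subalgebra.one_mem _) ?_) ?_
    · exact Subalgebra.smul_mem _ (Algebra.self_mem_adjoin_singleton _ _) (⟨_, hc⟩ : 𝒪[K])
    · exact Subalgebra.smul_mem _ (mul_mem (Algebra.self_mem_adjoin_singleton _ _) (Algebra.self_mem_adjoin_singleton _ _)) (⟨_, hc'⟩ : 𝒪[K])
  -- conclude by ★ order-stability: `γ_b·Λ = Λ ↔ X·Λ ⊆ Λ`, and `X·Λ ⊆ Λ` is the defect-set membership by definition (H12)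
  rw [mapGL_eq_iff_map_toLin'_le _ Γ hu hu' hXm]
  rfl

end ProofA0

end Literature.NumberTheory.Automorphic.UnitaryThreeFourFrame

end
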